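import Summits.QuantumFields.QCD.Theses.SpectralDefectExtinction
import Literature.Barriers.QuantumFields.WilsonDeterminantSign
import Literature.MathematicalPhysics.QuantumFieldTheory.FermionFlow
import Literature.MathematicalPhysics.QuantumFieldTheory.SpectralDefectDensity

/-!
# Sketch — crux-ideate r1 k3 for `SpectralDefectExtinction.TipPricing` (stmt-QuantumFields-8967)

First lemmas of three idea cards (they only need to ELABORATE; `sorry` marks what the line proves first):

* `crossing-coarea`            — `weylWindow_of_realRoot`, `flowZero_iff_realRoot`
* `local-bump-determinant`     — `det_sq_le_bump_of_smallMode`, `wilsonDet_sq_le_bump`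
* `laplacian-floor-lifshitz`   — `laplacianForm_eq_linkSum`, `re_root_ge_of_laplacianCoercive`,
                                  `laplacianForm_ge_of_dropLinks` (Neumann bracketing)
* `ims-bad-box-count`          — `card_le_of_halfMass_span`, `ims_wilson`
-/

namespace Summit.QuantumFields.QCD.Cruxes.TipPricing.Ideas

open Literature.MathematicalPhysics Literature.MathematicalPhysics.QuantumLattice
  Literature.MathematicalPhysics.QuantumFieldTheory Literature.Probability.LatticeModels
open Literature.Barriers.QuantumFields.WilsonDeterminant
open Matrix
open scoped Classical

/-! ## Card `crossing-coarea` -/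

/-- **Flow zeros are real modes** (the hinge of the coarea count): `det Γ₅D_W(U,m,1) = 0` iff `-m` is a
(real) eigenvalue of the massless Wilson operator. -/
theorem flowZero_iff_realRoot :
    ∀ (L : ℕ) [NeZero L] (U : GaugeConfig 4 L SU3) (m : ℝ),
      (hermitianWilsonDirac (fundamentalRep (Fin 3)) U m 1).det = 0 ↔
        (wilsonDirac (fundamentalRep (Fin 3)) U 0 1).charpoly.IsRoot (-(m : ℂ)) := by
  sorry

/-- **Weyl window**: a real eigenvalue `lam` of `D_W(U,0,1)` forces, for every bare mass `m` with
`|m + lam| < ε`, at least one eigenvalue of the Hermitian Wilson–Dirac operator `Γ₅ D_W(U,m,1)` in `(-ε, ε)`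
(`Γ₅D_W(U,m,1) - Γ₅D_W(U,-lam,1) = (m+lam)Γ₅` has norm `|m+lam|`, and `Γ₅D_W(U,-lam,1)` is singular).
Integrated over `m` and in expectation (Fatou, zeros isolated) this is the coarea/Kac–Rice pricing
`E #{real modes in (λ₁,λ₂)} ≤ liminf_{ε→0} (2ε)⁻¹ ∫_{-λ₂-ε}^{-λ₁+ε} E N_ε(m) dm`. -/
theorem weylWindow_of_realRoot :
    ∀ (L : ℕ) [NeZero L] (U : GaugeConfig 4 L SU3) (lam m ε : ℝ),
      (wilsonDirac (fundamentalRep (Fin 3)) U 0 1).charpoly.IsRoot (lam : ℂ) →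
      |m + lam| < ε →
      1 ≤ (hermitianWilsonDirac (fundamentalRep (Fin 3)) U m 1).charpoly.roots.countP
            (fun z : ℂ => |z.re| < ε) := by
  sorry

/-! ## Card `local-bump-determinant` -/

/-- **Determinant self-pricing by a local spectral bump** (abstract, approximate-eigenvector form): if a
Hermitian `H` has a vector `ψ ≠ 0` with `‖Hψ‖ ≤ ε‖ψ‖` carrying at least half of its mass in the range of an
orthogonal projection `P`, then `det(H)² ≤ (2ε²/μ²)·det(H² + μ²P)` for every `μ > 0`
(`det(H²+μ²P) = det(H²)·det(1 + μ² H⁻¹PH⁻¹)` and, with `φ = Hψ/‖Hψ‖`, `⟨φ, H⁻¹PH⁻¹φ⟩ = ‖Pψ‖²/‖Hψ‖² ≥ 1/(2ε²)`,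
while `det(1 + X) ≥ 1 + λ_max(X)` for `X ≥ 0`). The SAME `ψ` serves every flavour `g` with `ε_g = ε + |m_g - m_f|`. -/
theorem det_sq_le_bump_of_smallMode :
    ∀ {n : Type} [Fintype n] [DecidableEq n] (H P : Matrix n n ℂ) (ψ : n → ℂ) (ε μ : ℝ),
      H.IsHermitian → P.IsHermitian → P * P = P →
      ψ ≠ 0 → (∑ i, ‖(H *ᵥ ψ) i‖ ^ 2) ≤ ε ^ 2 * ∑ i, ‖ψ i‖ ^ 2 → 0 < ε → 0 < μ →
      (1 / 2 : ℝ) * (∑ i, ‖ψ i‖ ^ 2) ≤ ∑ i, ‖(P *ᵥ ψ) i‖ ^ 2 →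
      ‖H.det‖ ^ 2 ≤ (2 * ε ^ 2 / μ ^ 2) * ‖(H * H + ((μ ^ 2 : ℝ) : ℂ) • P).det‖ := by
  sorry

/-- **Wilson instance**: a `(1/2)`-box-localised `ε`-approximate zero mode of `Γ₅D_W(U,m,1)`
prices the flavour's own weight: `|det D_W(U,m,1)|² ≤ (2ε²/μ²)·det((Γ₅D_W)² + μ²·1_B ⊗ 1)`, where `1_B` is
the site projector onto the box `B` (a LOCAL, positive modification of the two-flavour weight). -/
theorem wilsonDet_sq_le_bump :
    ∀ (L : ℕ) [NeZero L] (U : GaugeConfig 4 L SU3) (m ε μ : ℝ) (B : Finset (TorusSite 4 L))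
      (v : QuarkIdx L → ℂ),
      v ≠ 0 →
      (∑ i, ‖((hermitianWilsonDirac (fundamentalRep (Fin 3)) U m 1) *ᵥ v) i‖ ^ 2) ≤ ε ^ 2 * ∑ i, ‖v i‖ ^ 2 →
      0 < ε → 0 < μ → IsBoxLocalised v B (1 / 2) →
      ‖fermionDet (wilsonDirac (fundamentalRep (Fin 3)) U m 1)‖ ^ 2 ≤
        (2 * ε ^ 2 / μ ^ 2) *
          ‖(hermitianWilsonDirac (fundamentalRep (Fin 3)) U m 1 *
                hermitianWilsonDirac (fundamentalRep (Fin 3)) U m 1 +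
              ((μ ^ 2 : ℝ) : ℂ) •
                Matrix.diagonal (fun i : QuarkIdx L => if i.1 ∈ B then (1 : ℂ) else 0)).det‖ := by
  sorry

/-! ## Card `laplacian-floor-lifshitz` -/

/-- **The covariant-Laplacian form is a sum of link squares**:
`Re⟨φ, (-Δ_U)φ⟩ = Σ_{x,μ} ‖U(x,μ)φ(x+μ̂) - φ(x)‖²` (tree `covariantLaplacian`, fundamental `SU(3)`). -/
theorem laplacianForm_eq_linkSum :
    ∀ (L : ℕ) [NeZero L] (U : GaugeConfig 4 L SU3) (φ : TorusSite 4 L × Fin 3 → ℂ),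
      (star φ ⬝ᵥ ((-covariantLaplacian (fundamentalRep (Fin 3)) U) *ᵥ φ)).re =
        ∑ x, ∑ μ, ∑ a,
          ‖(∑ b, (U (x, μ) : Matrix (Fin 3) (Fin 3) ℂ) a b * φ (QuantumFieldTheory.Site.shift x μ, b)) -
              φ (x, a)‖ ^ 2 := by
  sorry

/-- **Laplacian floor**: if `-Δ_U ≥ c` as a quadratic form on colour fields, then every eigenvalue `z` of
`D_W(U,m,1)` has `Re z ≥ m + c/2` — because `D_W + D_Wᴴ = (2m - Δ_U) ⊗ 1_spin` at `r = 1`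
(numerical range). In particular every REAL mode of the massless operator lies above `½ λ_min(-Δ_U)`. -/
theorem re_root_ge_of_laplacianCoercive :
    ∀ (L : ℕ) [NeZero L] (U : GaugeConfig 4 L SU3) (m c : ℝ),
      (∀ φ : TorusSite 4 L × Fin 3 → ℂ,
          c * (∑ i, ‖φ i‖ ^ 2) ≤ (star φ ⬝ᵥ ((-covariantLaplacian (fundamentalRep (Fin 3)) U) *ᵥ φ)).re) →
      ∀ z : ℂ, (wilsonDirac (fundamentalRep (Fin 3)) U m 1).charpoly.IsRoot z → m + c / 2 ≤ z.re := by
  sorry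

/-- **Neumann bracketing** (dropping links lowers the form): for every set `K` of links, the Laplacian form
dominates the same sum restricted to links outside `K` — so `λ_min(-Δ_U)` on the torus is at least the minimum
over the blocks of a partition of the block "Neumann" ground energies (each a LOCAL functional of `U`). -/
theorem laplacianForm_ge_of_dropLinks :
    ∀ (L : ℕ) [NeZero L] (U : GaugeConfig 4 L SU3) (K : Finset (TorusSite 4 L × Fin 4))
      (φ : TorusSite 4 L × Fin 3 → ℂ),
      (∑ e ∈ (Finset.univ : Finset (TorusSite 4 L × Fin 4)).filter (· ∉ K), ∑ a,
          ‖(∑ b, (U e : Matrix (Fin 3) (Fin 3) ℂ) a b * φ (QuantumFieldTheory.Site.shift e.1 e.2, b)) -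
              φ (e.1, a)‖ ^ 2) ≤
        (star φ ⬝ᵥ ((-covariantLaplacian (fundamentalRep (Fin 3)) U) *ᵥ φ)).re := by
  sorry

/-! ## Card `ims-bad-box-count` -/

/-- **Half-mass subspaces are small**: if `k` orthonormal quark vectors span a subspace ALL of whose vectors carry
at least half of their ℓ²-mass on the site set `S`, then `k ≤ 24·|S|` (`tr(Q 1_S Q) ≥ ½ tr Q` and `≤ rank 1_S = 12|S|`).
With IMS localisation ("every ε-approximate zero mode of `D_W + m′` is ½-localised on the union of the boxes that are
not δ-coercive at `m′`") this turns the zero-window DOS into `24 × #{sites of bad boxes}`, deterministically. -/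
theorem card_le_of_halfMass_span :
    ∀ (L : ℕ) [NeZero L] (S : Finset (TorusSite 4 L)) (k : ℕ) (w : Fin k → QuarkIdx L → ℂ),
      (∀ i j : Fin k, star (w i) ⬝ᵥ w j = if i = j then (1 : ℂ) else 0) →
      (∀ c : Fin k → ℂ, IsBoxLocalised (∑ i, c i • w i) S (1 / 2)) →
      k ≤ 24 * S.card := by
  sorry

/-- **IMS for a nearest-neighbour operator** (the localisation inequality the count uses): for the massive Wilson
operator `T = D_W(U,m,1)` and real site cutoffs `χ_B` with `Σ_B χ_B(x)² = 1`, the local pieces are controlled by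
the global one plus commutators, `Σ_B ‖T(χ_B ψ)‖² ≤ 2‖Tψ‖² + 2 Σ_B ‖[T, χ_B]ψ‖²`; each commutator only involves
hops across the cutoff's variation (`|χ_B(x) − χ_B(x±μ̂)| ≤ 1/R` makes it `O(1/R)`). -/
theorem ims_wilson :
    ∀ (L : ℕ) [NeZero L] (U : GaugeConfig 4 L SU3) (m : ℝ) (ι : Type) [Fintype ι]
      (χ : ι → TorusSite 4 L → ℝ), (∀ x, ∑ b, χ b x ^ 2 = 1) →
      ∀ ψ : QuarkIdx L → ℂ,
        ∑ b, ∑ i, ‖(wilsonDirac (fundamentalRep (Fin 3)) U m 1 *ᵥ (fun j => (χ b j.1 : ℂ) * ψ j)) i‖ ^ 2 ≤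
          2 * ∑ i, ‖(wilsonDirac (fundamentalRep (Fin 3)) U m 1 *ᵥ ψ) i‖ ^ 2 +
            2 * ∑ b, ∑ i, ‖(wilsonDirac (fundamentalRep (Fin 3)) U m 1 *ᵥ (fun j => (χ b j.1 : ℂ) * ψ j) -
                (fun j => (χ b j.1 : ℂ) * (wilsonDirac (fundamentalRep (Fin 3)) U m 1 *ᵥ ψ) j)) i‖ ^ 2 := by
  sorry

end Summit.QuantumFields.QCD.Cruxes.TipPricing.Ideas
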